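import Mathlib
import Summits.Ventures.PercRepro.TriangleCapStarFamilyDefs

/-!
# PercRepro — THE STAR FAMILY WITH A SHORT LIST OF CENTRE ROWS: THE INDEX FUNCTIONS AND THEIR PHASES (p3, gen 57;
part 346)

The star family of part 315 with EVERY centre row `ρ < Rc` short by `sh ρ` (`sh : ℕ → ℕ`, `sh ρ ≤ D − 1`): `a`
special non-neighbours `1, …, a` joined by inside edges to one centre `a + Q + 1`, `Q` regular non-neighbours
`a + 1, …, a + Q`; the rows (leaves of `w`) are `Rc ≥ 1` CENTRE ROWS `ℓ + 1, …, ℓ + Rc` (the row `ρ` = the centre plus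
`D − 1 − sh ρ` regular columns), `D − 1` OUTER ROWS (each = every special plus `D − a` regular columns) and `E` EXTRA
ROWS (each = `D` regular columns).  The regular columns are swept cyclically (`a + 1 + (p mod Q)`) through the
regular slots of the rows in order — the rows are the blocks of the cyclic block witness of part 288 (`rfMulti`, block
sizes `kSFL`): the left ends are `lfSF` of part 315, the right ends `rfSFL` on `Rc + a (D − 1) + Q D` indices, in
three phases (centre pairs, special pairs, regular pairs); the incidence identity is
`Rc (D − 1) + (D − 1)(D − a) + E D = Q D + Σ_{ρ < Rc} sh ρ`.  The one- and two-short families of parts 315 and 339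
are the lists `sh = [short, 0, …]` and `[sh0, sh1, 0, …]`; the families `k` below the thresholds need `k + 1` short
rows.  Axioms: standard.
-/
namespace PercRepro

namespace TriangleCap

namespace C047

open Finset

/-- The regular-slot sizes of the rows: the centre row `ρ < Rc` carries `D − 1 − sh ρ` regular columns, the `D − 1`
outer rows `D − a`, the extra rows `D`. -/
def kSFL (D a Rc : ℕ) (sh : ℕ → ℕ) (ρ : ℕ) : ℕ :=
  if ρ < Rc then D - 1 - sh ρ else if ρ < Rc + (D - 1) then D - a else D

/-- The right ends: the centre row `ℓ + 1 + i`, the outer row `ℓ + 1 + Rc + ⌊(i − Rc) / a⌋`, the block row of the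
regular position. -/
def rfSFL (ℓ D a Rc : ℕ) (sh : ℕ → ℕ) (E i : ℕ) : ℕ :=
  if i < Rc then ℓ + 1 + i
  else if i < Rc + a * (D - 1) then ℓ + 1 + Rc + (i - Rc) / a
  else rfMulti ℓ (kSFL D a Rc sh) (Rc + (D - 1) + E) (i - Rc - a * (D - 1))

/-- The centre rows. -/
theorem rfSFL_phaseC (ℓ D a Rc : ℕ) (sh : ℕ → ℕ) (E i : ℕ) (hi : i < Rc) : rfSFL ℓ D a Rc sh E i = ℓ + 1 + i := by
  unfold rfSFL
  rw [if_pos hi]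

/-- The outer rows. -/
theorem rfSFL_phaseS (ℓ D a Rc : ℕ) (sh : ℕ → ℕ) (E i : ℕ) (hi : i < a * (D - 1)) :
    rfSFL ℓ D a Rc sh E (Rc + i) = ℓ + 1 + Rc + i / a := by
  unfold rfSFL
  rw [if_neg (by omega), if_pos (by omega), Nat.add_sub_cancel_left]

/-- The block rows. -/
theorem rfSFL_phaseR (ℓ D a Rc : ℕ) (sh : ℕ → ℕ) (E i : ℕ) :
    rfSFL ℓ D a Rc sh E (Rc + a * (D - 1) + i) = rfMulti ℓ (kSFL D a Rc sh) (Rc + (D - 1) + E) i := by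
  unfold rfSFL
  rw [if_neg (by omega), if_neg (by omega)]
  have : Rc + a * (D - 1) + i - Rc - a * (D - 1) = i := by omega
  rw [this]

/-- **THE BLOCK SUM:** the regular slots of all rows number `Q D` under the incidence identity
`Rc (D − 1) + (D − 1)(D − a) + E D = Q D + Σ_{ρ < Rc} sh ρ`. -/
theorem blockSum_kSFL (D a Rc : ℕ) (sh : ℕ → ℕ) (E Q : ℕ) (_hRc : 1 ≤ Rc) (hsh : ∀ ρ < Rc, sh ρ + 1 ≤ D)
    (hinc : Rc * (D - 1) + (D - 1) * (D - a) + E * D = Q * D + ∑ ρ ∈ range Rc, sh ρ) :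
    blockSum (kSFL D a Rc sh) (Rc + (D - 1) + E) = Q * D := by
  unfold blockSum
  rw [range_eq_Ico, ← sum_Ico_consecutive _ (Nat.zero_le Rc) (by omega : Rc ≤ Rc + (D - 1) + E),
    ← sum_Ico_consecutive _ (by omega : Rc ≤ Rc + (D - 1)) (by omega : Rc + (D - 1) ≤ Rc + (D - 1) + E)]
  have h1 : ∑ x ∈ Ico 0 Rc, kSFL D a Rc sh x + ∑ ρ ∈ range Rc, sh ρ = Rc * (D - 1) := by
    rw [← range_eq_Ico, ← sum_add_distrib]
    have : ∑ ρ ∈ range Rc, (kSFL D a Rc sh ρ + sh ρ) = ∑ ρ ∈ range Rc, (D - 1) := by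
      apply sum_congr rfl
      intro ρ hρ
      unfold kSFL
      rw [if_pos (mem_range.mp hρ)]
      exact Nat.sub_add_cancel (by have := hsh ρ (mem_range.mp hρ); omega)
    rw [this, sum_const, card_range, smul_eq_mul]
  have h2 : ∑ x ∈ Ico Rc (Rc + (D - 1)), kSFL D a Rc sh x = (D - 1) * (D - a) := by
    rw [sum_const_nat (m := D - a) (fun x hx => by
      rw [mem_Ico] at hx
      unfold kSFL
      rw [if_neg (by omega), if_pos (by omega)]), Nat.card_Ico]
    have e : Rc + (D - 1) - Rc = D - 1 := by omega
    rw [e]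
  have h3 : ∑ x ∈ Ico (Rc + (D - 1)) (Rc + (D - 1) + E), kSFL D a Rc sh x = E * D := by
    rw [sum_const_nat (m := D) (fun x hx => by
      rw [mem_Ico] at hx
      unfold kSFL
      rw [if_neg (by omega), if_neg (by omega)]), Nat.card_Ico]
    have e : Rc + (D - 1) + E - (Rc + (D - 1)) = E := by omega
    rw [e]
  omega

/-- The block sizes are at most `Q`: `D − 1 ≤ Q`, and `D ≤ Q` when there are extra rows. -/
theorem kSFL_le (D a Rc : ℕ) (sh : ℕ → ℕ) (E Q ρ : ℕ) (ha : 1 ≤ a) (hQ1 : D ≤ Q + 1) (hQE : 1 ≤ E → D ≤ Q)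
    (hρ : ρ < Rc + (D - 1) + E) : kSFL D a Rc sh ρ ≤ Q := by
  unfold kSFL
  split_ifs with h1 h2
  · omega
  · omega
  · exact hQE (by omega)

/-- The bounds of the right ends: `ℓ + 1 ≤ rfSFL i < ℓ + 1 + (Rc + (D − 1) + E)` on the index range. -/
theorem rfSFL_bounds (ℓ D a Rc : ℕ) (sh : ℕ → ℕ) (E Q i : ℕ) (ha : 1 ≤ a) (hRc : 1 ≤ Rc) (hsh : ∀ ρ < Rc, sh ρ + 1 ≤ D)
    (hinc : Rc * (D - 1) + (D - 1) * (D - a) + E * D = Q * D + ∑ ρ ∈ range Rc, sh ρ) (hi : i < Rc + a * (D - 1) + Q * D) :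
    ℓ + 1 ≤ rfSFL ℓ D a Rc sh E i ∧ rfSFL ℓ D a Rc sh E i < ℓ + 1 + (Rc + (D - 1) + E) := by
  unfold rfSFL
  split_ifs with h1 h2
  · omega
  · have hdiv : (i - Rc) / a < D - 1 := by
      rw [Nat.div_lt_iff_lt_mul (by omega)]
      have := Nat.mul_comm a (D - 1)
      omega
    have h0 := Nat.zero_le ((i - Rc) / a)
    refine ⟨by omega, ?_⟩
    calc ℓ + 1 + Rc + (i - Rc) / a < ℓ + 1 + Rc + (D - 1) := Nat.add_lt_add_left hdiv _
      _ ≤ ℓ + 1 + (Rc + (D - 1) + E) := by omega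
  · have hb := rfMulti_bounds ℓ (kSFL D a Rc sh) (Rc + (D - 1) + E) (i - Rc - a * (D - 1)) (by
      rw [blockSum_kSFL D a Rc sh E Q hRc hsh hinc]
      omega)
    exact hb

/-- The centre pairs lie on the centre rows. -/
theorem rfSFL_of_centre (ℓ D a Rc : ℕ) (sh : ℕ → ℕ) (E i : ℕ) (hi : i < Rc) :
    rfSFL ℓ D a Rc sh E i < ℓ + 1 + Rc := by
  rw [rfSFL_phaseC ℓ D a Rc sh E i hi]
  omega

/-- The special pairs lie on the outer rows. -/
theorem rfSFL_of_special (ℓ D a Rc : ℕ) (sh : ℕ → ℕ) (E i : ℕ) (hi1 : Rc ≤ i) (hi2 : i < Rc + a * (D - 1)) :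
    ℓ + 1 + Rc ≤ rfSFL ℓ D a Rc sh E i := by
  obtain ⟨i', rfl⟩ : ∃ i', i = Rc + i' := ⟨i - Rc, by omega⟩
  rw [rfSFL_phaseS ℓ D a Rc sh E i' (by omega)]
  exact Nat.le_add_right _ _

end C047

end TriangleCap

end PercRepro
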